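import Literature.Probability.LatticeModels.RandomClusterFreePercolationProbability
import Summits.CriticalPhenomena.PercolationContinuityZ3.Theorems.Transplant.FKUniqueAtCriticalOfRaoufi
import Literature.Probability.Percolation.CriticalContinuity
import Literature.Barriers.CriticalPhenomena.RandomClusterFirstOrderNarrow
import Summits.CriticalPhenomena.PercolationContinuityZ3.Statement
import HarnessLib
import HarnessLib.Audit

/-!
# FK-continuity cell, FO-01: the TARGET statements of the random-cluster (FK) continuity transplant,
# typed over tree declarations, with the seams the tree already decides

Definitions file of the `fk-continuity` build cell (bschramm lane; helper of `stmt-CriticalPhenomena-4575`),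
row FO-01 of `run/shared/lean/prim/bschramm/fk-continuity/FANOUT-PLAN.md`; the statements are those of the
referee-signed SCOPING.md §3.2/§3.9 (scratch certificates `prim-bschramm-fk-4/FKContinuityTargets.lean` and
`prim-bschramm-fk-4-g4/TargetsPreAudit.lean`, farm rc 0). builds on p205010 (kernel theorem, internal audit
signed; external expert review pending).

Objects (all existing tree declarations): `thetaWired d p q = θ¹(p,q)` and `rcCriticalProb d q = p_c(q)`
(`Literature/Barriers/CriticalPhenomena/RandomClusterFirstOrder.lean`, Grimmett 2006 (5.1)–(5.2)),
`thetaFree d p q = θ⁰(p,q)` (`Literature/Probability/LatticeModels/RandomClusterFreePercolationProbability.lean`,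
(5.1) with `b = 0`), `FK.FKUniqueAt d p q := θ⁰(p,q) = θ¹(p,q)` (`Theorems/Transplant/FKUniqueAtCriticalOfRaoufi.lean`),
the Edwards–Sokal dictionary `thetaWired_fkIsingParam_two_eq_spontaneousMagnetization` /
`rcCriticalProb_two_eq_fkIsingParam_criticalBeta` (Grimmett 2006 Thm. (5.17), (5.19)), the barrier facts
`RandomClusterFirstOrder(Narrow)` (Grimmett 2006 Thm. (7.33)(b)), and the summit conjunct `PercolationContinuityZ3`.

Targets (PROGRAMME STATEMENTS — `Prop`s, never asserted; their status per `q` is SCOPING.md §3.3):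
* `FK.FKContinuityWired d q`  — T_W: `θ¹(p_c(q), q) = 0`, continuity of the FK(`q`) transition proper;
* `FK.FKContinuityFree d q`   — T_F: `θ⁰(p_c(q), q) = 0`, Grimmett 2006 Conj. (6.32)(a) — the DECIDING target;
* `FK.FKTransferAtCritical d q` — T_U: T_F → T_W (the uniqueness seam at `p_c(q)`);
* `FK.FKContinuityZ3` (brief's form: wired, `q ∈ [1,2]`, `d = 3`), `FK.FKFreeCriticalZ3` (free, every `q ≥ 1`),
  and the closed FILING forms `FK.FKFreeCriticalZ3Open` (free, `q ∈ (1,2]`), `FK.FKTransferZ3Open`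
  (transfer, `q ∈ (1,2)` = Raoufi 2020 Question 4); the wired-∀`q ≥ 1` form is NOT defined — it is the
  barrier-refuted negative control (`not_wiredAllQ`).

Seams PROVED here (unconditional unless a named-fact hypothesis is visible in the signature):
`free_of_wired` (T_W → T_F, `q ≥ 1`), `wired_iff_free_and_transfer`; `q = 2`: `wired_two`, `free_two` (`d ≥ 3`,
tree theorems via ADS 2015), `transfer_two_of_three_le`, `transfer_two_of_raoufi` (every `d ≥ 2`, CONDITIONAL on
the named fact `Raoufi2020_nn_freeCorr_eq_plusCorr`), `ising_continuity_of_wired_two` / `wired_two_of_ising_continuity`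
/ `wired_two_iff_ising_continuity` (T_W(d,2) ↔ `m*(β_c) = 0`, `d ≥ 2`); barrier placement:
`wired_fails_for_large_q`, `free_holds_for_large_q`, `not_wiredAllQ` (hypothesis `RandomClusterFirstOrderNarrow`);
non-degeneracy: `thetaFree_one_left` (θ⁰(1,q) = 1, NEW), `thetaFree_not_identically_zero`,
`thetaWired_not_identically_zero`, `thetaFree_zero_left'`; glue: `freeAllQ_of_wiredAllQ`, `freeOpen_of_freeAllQ`,
`continuityZ3_of_pieces` (`FKFreeCriticalZ3Open → FKTransferZ3Open → FKContinuityWired 3 1 → FKContinuityZ3`).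
The `q = 1` identification (`FKContinuityWired 3 1 ↔ PercolationContinuityZ3`, gap G1) is FO-02's file
`Theorems/FK/ContinuityQOneBridge.lean`; nothing here uses it.

Honest framing (SCOPING §3.4, referee §5.4): `θ¹(p_c(2),2) = 0` on `ℤ^d`, `d ≥ 3`, is ALREADY a tree theorem
(`thetaWired_rcCriticalProb_two_eq_zero`, ADS 2015 Cor. 1.5(1)); a proof of `FKContinuityFree 3 2` inside the FK
chain would be a SECOND proof whose new content is the removal of reflection positivity from the hypothesis of
ADS Thm. 1.2. Nothing in this file claims any target.
[cite: Grimmett2006, §5.1 (5.1)–(5.3), Thm. (5.16), Thm. (5.17) (5.19), Conj. (6.32), Thm. (7.33)(b)]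
[cite: AizenmanDuminilCopinSidoraviciusCMP2015, Thm. 1.2 and Cor. 1.5(1)] [cite: Raoufi2020, Prop. 1, Cor. 3, Question 4]
-/

noncomputable section

namespace Summit.CriticalPhenomena.PercolationContinuityZ3.Theorems

namespace FK

open Literature.Probability.LatticeModels Literature.Barriers.CriticalPhenomena
open Literature.Probability.Percolation

/-! ### 1. The target statements -/

/-- **T_W(d,q) — WIRED continuity at criticality**: `θ¹(p_c(q), q) = 0` for the random-cluster model on `ℤ^d`
(`θ¹` is right-continuous in `p`, so this is continuity of `p ↦ θ¹(p,q)` at `p_c(q)`; Grimmett 2006 Thm. (5.16)(b)).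
Expected TRUE for `q ∈ [1, Q(d)]` and FALSE for `q > Q(d)` (first-order transition, Thm. (7.33)(b)). A programme
statement, never asserted. [cite: Grimmett2006, §5.1 (5.1)–(5.2) and Thm. (5.16)] -/
@[conjecture] def FKContinuityWired (d : ℕ) (q : ℝ) : Prop := thetaWired d (rcCriticalProb d q) q = 0

/-- **T_F(d,q) — the FREE phase does not percolate at criticality**: `θ⁰(p_c(q), q) = 0` — Grimmett 2006
Conj. (6.32)(a) ("`θ⁰(p_c(q), q) = 0` for `q ∈ [1, ∞)`", every `d ≥ 2`). The DECIDING target of the transplant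
(the only boundary condition a `q`-uniform Kozma–Nitzan-type chain can reach; SCOPING §3.5). A programme statement,
never asserted. [cite: Grimmett2006, Conj. (6.32)(a)] -/
@[conjecture] def FKContinuityFree (d : ℕ) (q : ℝ) : Prop := thetaFree d (rcCriticalProb d q) q = 0

/-- **T_U(d,q) — the TRANSFER at criticality**: free non-percolation implies wired non-percolation at `p_c(q)`
(given T_F, equivalent to the boundary-condition seam `FK.FKUniqueAt d (p_c(q)) q`, i.e. uniqueness of the
random-cluster measure at `p_c(q)`; Grimmett 2006 Thm. (5.16)(c) with Thm. (4.63)). Open in print for `q ∈ (1,2)`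
(Raoufi 2020, Question 4). [cite: Grimmett2006, Thm. (5.16)(c) and Thm. (4.63)] [cite: Raoufi2020, Question 4] -/
@[conjecture] def FKTransferAtCritical (d : ℕ) (q : ℝ) : Prop := FKContinuityFree d q → FKContinuityWired d q

/-- **The brief's target**: continuity of the FK(`q`) transition on `ℤ³` for every `q ∈ [1,2]` (wired form).
Its `q = 1` instance is the summit conjunct `PercolationContinuityZ3` (FO-02's bridge), its `q = 2` instance the
tree theorem `thetaWired_rcCriticalProb_two_eq_zero`. [cite: Grimmett2006, Conj. (6.32) with (6.33)] -/
@[conjecture] def FKContinuityZ3 : Prop := ∀ q : ℝ, 1 ≤ q → q ≤ 2 → FKContinuityWired 3 q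

/-- **Programme form**: Grimmett's Conj. (6.32)(a) on `ℤ³` — the free phase does not percolate at `p_c(q)` for
every `q ≥ 1`. Its `q = 1` instance is the summit conjunct (regression instance, p205010), so a route files the
open-interval form `FKFreeCriticalZ3Open` instead (SCOPING §3.9(b)). [cite: Grimmett2006, Conj. (6.32)(a)] -/
@[conjecture] def FKFreeCriticalZ3 : Prop := ∀ q : ℝ, 1 ≤ q → FKContinuityFree 3 q

/-- **Filing form of the deciding crux**: `θ⁰(p_c(q), q) = 0` on `ℤ³` for `q ∈ (1,2]` — no instance is the
summit conjunct; the `q = 2` endpoint is decided in the tree (through ADS 2015), the open interval is open in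
print. [cite: Grimmett2006, Conj. (6.32)(a)] -/
@[conjecture] def FKFreeCriticalZ3Open : Prop := ∀ q : ℝ, 1 < q → q ≤ 2 → FKContinuityFree 3 q

/-- **The declared residual** for `q ∈ (1,2)`: the transfer T_U(3,q), i.e. uniqueness of the FK measure at
`p_c(q)` — Raoufi 2020, Question 4 (open). [cite: Raoufi2020, Question 4] [cite: Grimmett2006, Thm. (5.16)(c)] -/
@[conjecture] def FKTransferZ3Open : Prop := ∀ q : ℝ, 1 < q → q < 2 → FKTransferAtCritical 3 q

/-- Unfolding of T_W. [cite: Grimmett2006, §5.1 (5.1)–(5.2)] -/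
theorem fkContinuityWired_iff (d : ℕ) (q : ℝ) :
    FKContinuityWired d q ↔ thetaWired d (rcCriticalProb d q) q = 0 := Iff.rfl

/-- Unfolding of T_F. [cite: Grimmett2006, §5.1 (5.1) (b = 0)] -/
theorem fkContinuityFree_iff (d : ℕ) (q : ℝ) :
    FKContinuityFree d q ↔ thetaFree d (rcCriticalProb d q) q = 0 := Iff.rfl

/-! ### 2. Seams between the three targets -/

/-- **Wired ⇒ free**, every `q ≥ 1`: `0 ≤ θ⁰ ≤ θ¹` (comparison of boundary conditions, Grimmett 2006
Lemma (4.14)(b); tree: `thetaFree_le_thetaWired`). [cite: Grimmett2006, Lemma (4.14)(b) and §5.1 (5.3)] -/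
theorem free_of_wired {d : ℕ} {q : ℝ} (hq : 1 ≤ q) (h : FKContinuityWired d q) : FKContinuityFree d q := by
  unfold FKContinuityFree
  refine le_antisymm ?_ (thetaFree_nonneg _ _)
  calc thetaFree d (rcCriticalProb d q) q ≤ thetaWired d (rcCriticalProb d q) q :=
        thetaFree_le_thetaWired (rcCriticalProb_mem_Icc d q) hq
    _ = 0 := h

/-- T_W ↔ T_F ∧ T_U (`q ≥ 1`): the content of wired continuity is exactly "free non-percolation + transfer".
[cite: Grimmett2006, Thm. (5.16)] -/
theorem wired_iff_free_and_transfer {d : ℕ} {q : ℝ} (hq : 1 ≤ q) :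
    FKContinuityWired d q ↔ FKContinuityFree d q ∧ FKTransferAtCritical d q :=
  ⟨fun h => ⟨free_of_wired hq h, fun _ => h⟩, fun ⟨hF, hU⟩ => hU hF⟩

/-- The transfer holds whenever the boundary-condition seam `θ⁰ = θ¹` holds at `p_c(q)`.
[cite: Grimmett2006, Thm. (5.16)(c)] -/
theorem transfer_of_fkUniqueAt {d : ℕ} {q : ℝ} (hu : FKUniqueAt d (rcCriticalProb d q) q) :
    FKTransferAtCritical d q := fun hF => by
  unfold FKContinuityWired
  rw [← (fkUniqueAt_iff _ _ _).1 hu]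
  exact hF

/-! ### 3. What the tree decides at `q = 2` -/

/-- `q = 2`, `d ≥ 3`: the wired target is ALREADY a tree theorem (Aizenman–Duminil-Copin–Sidoravicius 2015
Cor. 1.5(1) through the Edwards–Sokal dictionary; `thetaWired_rcCriticalProb_two_eq_zero`). Any proof of it inside
the FK chain is a SECOND proof. [cite: AizenmanDuminilCopinSidoraviciusCMP2015, Thm. 1.2 and Cor. 1.5(1)] -/
theorem wired_two {d : ℕ} (hd : 3 ≤ d) : FKContinuityWired d 2 :=
  thetaWired_rcCriticalProb_two_eq_zero hd

/-- `q = 2`, `d ≥ 3`: the free target is a tree theorem (`0 ≤ θ⁰ ≤ θ¹ = 0`), but proved THROUGH the wired one.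
[cite: AizenmanDuminilCopinSidoraviciusCMP2015, Cor. 1.5(1)] [cite: Grimmett2006, §5.1 (5.3)] -/
theorem free_two {d : ℕ} (hd : 3 ≤ d) : FKContinuityFree d 2 :=
  thetaFree_rcCriticalProb_two_eq_zero hd

/-- `q = 2`, `d ≥ 3`: the transfer holds (trivially: both sides vanish, `fkUniqueAt_criticalProb_two_of_three_le`).
[cite: AizenmanDuminilCopinSidoraviciusCMP2015, Cor. 1.5(1)] -/
theorem transfer_two_of_three_le {d : ℕ} (hd : 3 ≤ d) : FKTransferAtCritical d 2 :=
  transfer_of_fkUniqueAt (fkUniqueAt_criticalProb_two_of_three_le hd)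

/-- `q = 2`, every `d ≥ 2`: the transfer holds CONDITIONALLY on the named fact
`Raoufi2020_nn_freeCorr_eq_plusCorr` (Raoufi 2020 Prop. 1 / Cor. 3: `φ⁰ = φ¹` for FK–Ising at every `p`, by random
currents, no reflection positivity; unproved in the tree — hypothesis `h`). [cite: Raoufi2020, Prop. 1 and Cor. 3] -/
theorem transfer_two_of_raoufi (h : Raoufi2020_nn_freeCorr_eq_plusCorr) {d : ℕ} (hd : 2 ≤ d) :
    FKTransferAtCritical d 2 :=
  transfer_of_fkUniqueAt (fkUniqueAt_criticalProb_two_of_raoufi h d hd)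

/-- **The `q = 2` ⇒ Ising corollary, typed**: wired FK(2) continuity at `p_c(2)` gives continuity of the
spontaneous magnetisation of the nearest-neighbour Ising model at `β_c`, through the Edwards–Sokal dictionary
`θ¹(1 − e^{−2β}, 2) = m*(β)` (Grimmett 2006 Thm. (5.17), (5.19)) and `p_c(2) = 1 − e^{−2β_c}` (`d ≥ 2`).
[cite: Grimmett2006, Thm. (5.17) (5.19)] -/
theorem ising_continuity_of_wired_two {d : ℕ} (hd : 2 ≤ d) (h : FKContinuityWired d 2) :
    spontaneousMagnetization d (criticalBeta d) = 0 := by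
  have h' := h
  unfold FKContinuityWired at h'
  rwa [rcCriticalProb_two_eq_fkIsingParam_criticalBeta hd,
    thetaWired_fkIsingParam_two_eq_spontaneousMagnetization (by omega) (criticalBeta_nonneg d)] at h'

/-- Converse: Ising continuity at `β_c` gives wired FK(2) continuity at `p_c(2)` (`d ≥ 2`).
[cite: Grimmett2006, Thm. (5.17) (5.19)] -/
theorem wired_two_of_ising_continuity {d : ℕ} (hd : 2 ≤ d)
    (h : spontaneousMagnetization d (criticalBeta d) = 0) : FKContinuityWired d 2 := by
  unfold FKContinuityWired
  rwa [rcCriticalProb_two_eq_fkIsingParam_criticalBeta hd,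
    thetaWired_fkIsingParam_two_eq_spontaneousMagnetization (by omega) (criticalBeta_nonneg d)]

/-- T_W(d,2) ↔ `m*(β_c) = 0` (`d ≥ 2`). [cite: Grimmett2006, Thm. (5.17) (5.19)] -/
theorem wired_two_iff_ising_continuity {d : ℕ} (hd : 2 ≤ d) :
    FKContinuityWired d 2 ↔ spontaneousMagnetization d (criticalBeta d) = 0 :=
  ⟨ising_continuity_of_wired_two hd, wired_two_of_ising_continuity hd⟩

/-- **The SECOND-proof chain at `q = 2`, assembled modulo its two FK inputs** (SCOPING §3.4): if T_F(d,2) holds and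
the free Edwards–Sokal identity turns it into ADS's hypothesis `M̃_LRO(β_c) = 0` (FO-03a, hypothesis `hES`), then
ADS Thm. 1.2 (first assertion, RP-free, PROVED in the tree: `spontaneousMagnetization_criticalBeta_eq_zero_of_lroTildeSq_holds`)
gives `m*(β_c) = 0` and hence T_W(d,2), for every `d ≥ 2`. Random currents enter only through that tree theorem.
[cite: AizenmanDuminilCopinSidoraviciusCMP2015, Thm. 1.2 (first assertion)] [cite: Grimmett2006, Thm. (5.17) (5.18)–(5.19)] -/
theorem wired_two_of_free_two_of_freeES {d : ℕ} (hd : 2 ≤ d) (hF : FKContinuityFree d 2)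
    (hES : FKContinuityFree d 2 → lroTildeSq d (criticalBeta d) = 0) : FKContinuityWired d 2 :=
  wired_two_of_ising_continuity hd
    (spontaneousMagnetization_criticalBeta_eq_zero_of_lroTildeSq_holds hd (hES hF))

/-! ### 4. Barrier placement (hypothesis: the narrowed first-order barrier, a named fact) -/

/-- The narrowed first-order barrier REFUTES the wired target `q`-uniformly on `ℤ³`: for all large `q`,
`θ¹(p_c(q), q) > 0`. [cite: Grimmett2006, Thm. (7.33)(b)] -/
theorem wired_fails_for_large_q (hB : RandomClusterFirstOrderNarrow) :
    ∃ Q : ℝ, ∀ q : ℝ, Q < q → 1 ≤ q → ¬ FKContinuityWired 3 q := by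
  obtain ⟨Q, hQ⟩ := hB.z3
  exact ⟨Q, fun q hq h1 hW => (hQ q hq h1).2.ne' hW⟩

/-- The same barrier ASSERTS the free target for all large `q` (free decay at `p_c(q)`, Grimmett's (7.81)–(7.83)):
T_F is outside the barrier's reach — evasion by conclusion. [cite: Grimmett2006, Thm. (7.33)(b) and (7.81)–(7.83)] -/
theorem free_holds_for_large_q (hB : RandomClusterFirstOrderNarrow) :
    ∃ Q : ℝ, ∀ q : ℝ, Q < q → 1 ≤ q → FKContinuityFree 3 q := by
  obtain ⟨Q, hQ⟩ := hB.z3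
  refine ⟨Q, fun q hq h1 => ?_⟩
  exact (thetaFree_eq_zero_iff_mem_freeDecaySet (rcCriticalProb_mem_Icc 3 q) (by linarith)).2 (hQ q hq h1).1

/-- **Negative control**: the `q`-UNIFORM wired form "T_W(3,q) for every `q ≥ 1`" is refuted by the barrier
(`q := max Q 1 + 1`) — the reason the programme's `q`-uniform target is the FREE statement.
[cite: Grimmett2006, Thm. (7.33)(b)] -/
theorem not_wiredAllQ (hB : RandomClusterFirstOrderNarrow) : ¬ ∀ q : ℝ, 1 ≤ q → FKContinuityWired 3 q := by
  obtain ⟨Q, hQ⟩ := wired_fails_for_large_q hB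
  intro h
  have hq : 1 ≤ max Q 1 + 1 := by linarith [le_max_right Q 1]
  exact hQ (max Q 1 + 1) (by linarith [le_max_left Q 1]) hq (h _ hq)

/-! ### 5. Non-degeneracy of the functionals (vacuity classes A3/A5: junk `⨅/⨆` values) -/

section NonDegeneracy

variable {d : ℕ}

/-- Restricting the full edge configuration of `Λ_Δ` to `Λ ⊆ Δ` gives the full edge configuration of `Λ`. [folklore] -/
theorem finsetRestrict_edgeSet {V : Type*} {G : SimpleGraph V} {Λ Δ : Finset V} (h : Λ ⊆ Δ) :
    finsetRestrict h ((finsetGraph G Δ).edgeSet : BondConfig ↥Δ) = (finsetGraph G Λ).edgeSet := by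
  ext e
  induction e using Sym2.ind with
  | h a b =>
    rw [mem_finsetRestrict_iff, edgeLift_mk, SimpleGraph.mem_edgeSet, SimpleGraph.mem_edgeSet,
      adj_finsetIncl_iff]

/-- `φ⁰_{Λ_{n+1+k},1,q}(0 ↔ ∂Λ_{n+1}) = 1`: at `p = 1` the free box measure is the point mass at the full
configuration (`rcMeasure_real_one_left`), whose restriction to `Λ_{n+1}` joins the origin to `∂Λ_{n+1}` (`d ≥ 1`).
[cite: Grimmett2006, §4.2 (4.11)–(4.12) and §5.1 (5.1)] -/
theorem thetaFreeBox_one_left (hd : 0 < d) {q : ℝ} (hq : 0 < q) (n k : ℕ) :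
    thetaFreeBox d 1 q (n + 1) k = 1 := by
  have hmem : finsetRestrict (box_mono d (Nat.le_add_right (n + 1) k))
      ((finsetGraph (zdGraph d) (box d (n + 1 + k))).edgeSet : BondConfig ↥(box d (n + 1 + k)))
        ∈ originToBoundary d (n + 1) := by
    rw [finsetRestrict_edgeSet]
    exact edgeSet_mem_originToBoundary hd n
  rw [thetaFreeBox_eq_real]
  exact rcMeasure_real_one_left _ hq ∅ _ hmem

/-- **`θ⁰(1, q) = 1`** (`d ≥ 1`, `q > 0`): the free functional is not identically zero, so T_F is not
"true because `θ⁰ ≡ 0`". [cite: Grimmett2006, §5.1 (5.1)] -/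
theorem thetaFree_one_left (hd : 0 < d) {q : ℝ} (hq : 0 < q) : thetaFree d 1 q = 1 := by
  have hp : (1 : ℝ) ∈ Set.Icc (0 : ℝ) 1 := ⟨zero_le_one, le_rfl⟩
  refine le_antisymm (thetaFree_le_one hp hq) ?_
  rw [thetaFree_eq]
  refine le_ciInf fun n => ?_
  calc (1 : ℝ) = thetaFreeBox d 1 q (n + 1) 0 := (thetaFreeBox_one_left hd hq n 0).symm
    _ ≤ thetaFreeArm d 1 q (n + 1) := thetaFreeBox_le_thetaFreeArm hp hq _ _
    _ ≤ thetaFreeArm d 1 q n := thetaFreeArm_anti hp hq (Nat.le_succ n)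

/-- The free functional on `ℤ³` is not identically zero on `[0,1]`. [cite: Grimmett2006, §5.1 (5.1)] -/
theorem thetaFree_not_identically_zero {q : ℝ} (hq : 0 < q) :
    ¬ ∀ p ∈ Set.Icc (0 : ℝ) 1, thetaFree 3 p q = 0 := by
  intro h
  have := h 1 ⟨zero_le_one, le_rfl⟩
  rw [thetaFree_one_left (by norm_num) hq] at this
  exact one_ne_zero this

/-- The wired functional on `ℤ³` is not identically zero on `[0,1]` (tree: `thetaWired_one_left`).
[cite: Grimmett2006, §5.1 (5.1)] -/
theorem thetaWired_not_identically_zero {q : ℝ} (hq : 0 < q) :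
    ¬ ∀ p ∈ Set.Icc (0 : ℝ) 1, thetaWired 3 p q = 0 := by
  intro h
  have := h 1 ⟨zero_le_one, le_rfl⟩
  rw [thetaWired_one_left (by norm_num) hq] at this
  exact one_ne_zero this

/-- Both functionals vanish at `p = 0` (so neither target is false for the trivial reason); free side.
[cite: Grimmett2006, §5.1 (5.1)–(5.3)] -/
theorem thetaFree_zero_left' (d : ℕ) {q : ℝ} (hq : 1 ≤ q) : thetaFree d 0 q = 0 :=
  le_antisymm ((thetaFree_le_thetaWired ⟨le_rfl, zero_le_one⟩ hq).trans
    (thetaWired_zero_left d (one_pos.trans_le hq)).le) (thetaFree_nonneg _ _)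

end NonDegeneracy

/-! ### 6. Seams between the closed forms (the shape of a future route's `Assembly`) -/

/-- The (refuted) wired-∀q form would give the free-∀q form. [cite: Grimmett2006, §5.1 (5.3)] -/
theorem freeAllQ_of_wiredAllQ (h : ∀ q : ℝ, 1 ≤ q → FKContinuityWired 3 q) : FKFreeCriticalZ3 :=
  fun q hq => free_of_wired hq (h q hq)

/-- The free-∀q form gives the filing form on `(1,2]`. [folklore] -/
theorem freeOpen_of_freeAllQ (h : FKFreeCriticalZ3) : FKFreeCriticalZ3Open :=
  fun q hq _ => h q hq.le

/-- **Glue**: the brief's `FKContinuityZ3` from the filing form (deciding crux, `q ∈ (1,2]`), the residual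
(transfer, `q ∈ (1,2)`) and the two decided endpoints — `q = 2` the tree theorem, `q = 1` entering ONLY as the
hypothesis `h1 : FKContinuityWired 3 1` (= the summit conjunct by FO-02's bridge; regression instance p205010).
[cite: Grimmett2006, Conj. (6.32) with (6.33)] -/
theorem continuityZ3_of_pieces (hF : FKFreeCriticalZ3Open) (hU : FKTransferZ3Open)
    (h1 : FKContinuityWired 3 1) : FKContinuityZ3 := by
  intro q hq hq2
  rcases hq.eq_or_lt with rfl | hq'
  · exact h1
  rcases hq2.eq_or_lt with rfl | hq2'
  · exact wired_two (by norm_num)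
  exact hU q hq' hq2' (hF q hq' hq2)

/-- Conversely the brief's form contains the filing form's wired upgrade on `[1,2]`: for `q ∈ (1,2]`,
`FKContinuityZ3` gives T_F(3,q). [cite: Grimmett2006, §5.1 (5.3)] -/
theorem freeOpen_of_continuityZ3 (h : FKContinuityZ3) : FKFreeCriticalZ3Open :=
  fun q hq hq2 => free_of_wired hq.le (h q hq.le hq2)

end FK

end Summit.CriticalPhenomena.PercolationContinuityZ3.Theorems

end
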